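import Literature.Analysis.FunctionSpaces.PoissonPointProcess
import HarnessLib

/-!
# The Mapping Theorem for Poisson point processes, restricted form

Topic `Analysis/FunctionSpaces` (companion of `PoissonPointProcess.lean` and
`PoissonMappingHomeomorph.lean`). Kingman, *Poisson Processes* (1993), §2.3, **Mapping Theorem**
(p. 18) with §2.2, **Restriction Theorem** (p. 17): if `Π` is a Poisson process with mean measure
`μ` on `S`, `S₁ ⊆ S` is measurable and `f : S → T` is measurable, then `f(Π ∩ S₁)` is a Poisson
process on `T` with mean measure `B ↦ μ(f⁻¹ B ∩ S₁)` as soon as the image points are distinct; by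
the computation (2.24)–(2.26) preceding the Mapping Theorem, for `f` INJECTIVE on `S₁` the counts
of the image are `N*(B) = N(S₁ ∩ f⁻¹ B)`, Poisson of mean `μ(f⁻¹ B ∩ S₁)`, and independent over
disjoint `Bᵢ` (disjoint sets have disjoint inverse images) — no non-atomicity or σ-finiteness
hypothesis is then needed (Last–Penrose, *Lectures on the Poisson Process* (2017), Theorems 5.1
and 5.2, for the random-measure formalism).

The tree has this for translations (`IsPoissonPointProcess.translate_holds`), for restriction
alone (`IsPoissonPointProcess.restrict_holds`) and for global homeomorphisms `E ≃ₜ E'`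
(`IsPoissonPointProcess.mapHomeomorph`). This file does it for an arbitrary measurable map
`g : E → F` that is injective on a *relatively compact* measurable set `s ⊆ E` (conformal maps and
Möbius transformations restricted to a bounded window, charts, …): the configurations of the tree
are locally finite SETS (`PointConfig`), and the image `g '' (c ∩ s)` of the finite set `c ∩ s` is
again a (finite, hence locally finite) configuration of `F`, whatever the topology of `F`.

## Contents (namespace `Literature.Analysis.FunctionSpaces`)

* `PointConfig.imageRestrict g s c` — the configuration `g '' (c ∩ s)` of `F` (junk value `∅`
  when `c ∩ s` is infinite, which does not happen for relatively compact `s`,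
  `PointConfig.finite_inter_of_subset_isCompact`), with `carrier_`/`coe_imageRestrict`,
  `mem_imageRestrict_iff`, `imageRestrict_restrict`;
* `PointConfig.count_imageRestrict` — `N_{g(c ∩ s)}(t) = N_c(s ∩ g⁻¹ t)` for `g` injective on `s`
  (Kingman (2.25)), `count_imageRestrict_image`, and `PointConfig.measurable_imageRestrict`
  (measurability for the count σ-algebras);
* `IsPoissonPointProcess.map_imageRestrict` — **Mapping Theorem, restricted form**: the image law
  `P.map (PointConfig.imageRestrict g s)` of a Poisson point process with intensity `ν` is a Poisson
  point process on `F` with intensity `(ν.restrict s).map g` (`t ↦ ν (g⁻¹ t ∩ s)`).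

One definition (`PointConfig.imageRestrict`); no named facts. The identification of
`(ν.restrict s).map g` with a density on `g '' s` (change of variables) and uniqueness in law
(`IsPoissonPointProcess.unique_holds`) are deliberately NOT here.

## References

* J. F. C. Kingman, *Poisson Processes*, Oxford Studies in Probability 3, OUP (1993), §2.2
  Restriction Theorem (p. 17); §2.3 The Mapping Theorem, p. 18, (2.24)–(2.26). [`Kingman1993`]
* G. Last, M. Penrose, *Lectures on the Poisson Process*, CUP (2017), Theorem 5.1 (mapping
  theorem), Theorem 5.2 (restriction theorem). [`LastPenrose2017`]
-/

open MeasureTheory ProbabilityTheory Set Function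
open scoped ENNReal NNReal

namespace Literature.Analysis.FunctionSpaces

variable {E F : Type*} [TopologicalSpace E] [TopologicalSpace F]

namespace PointConfig

/-! ### Images of restricted configurations -/

open Classical in
/-- The image under `g : E → F` of the points of the configuration `c` lying in `s`, as a point
configuration of `F`: the set `g '' (c ∩ s)` whenever `c ∩ s` is finite (always the case for `s`
relatively compact, `finite_inter_of_subset_isCompact`), and the junk value `∅` otherwise (an
infinite image need not be locally finite in `F`). Kingman, *Poisson Processes* (1993), §2.3
(the random set `f(Π)`) after §2.2 (restriction `Π ∩ S₁`).
[cite: Kingman1993, §2.3 Mapping Theorem] -/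
protected noncomputable def imageRestrict (g : E → F) (s : Set E) (c : PointConfig E) :
    PointConfig F where
  carrier := if (c.carrier ∩ s).Finite then g '' (c.carrier ∩ s) else ∅
  finite_inter_isCompact K _ := by
    split_ifs with h
    · exact (h.image g).subset Set.inter_subset_left
    · simp

variable {g : E → F} {s : Set E}

/-- Carrier of the image of a restricted configuration with finitely many points in `s`:
`g '' (c ∩ s)` (Kingman 1993, §2.3). [cite: Kingman1993, §2.3] -/
theorem carrier_imageRestrict_of_finite {c : PointConfig E} (h : (c.carrier ∩ s).Finite) :
    (c.imageRestrict g s).carrier = g '' (c.carrier ∩ s) :=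
  if_pos h

/-- The junk case: if `c` has infinitely many points in `s`, the image configuration is empty.
[folklore] -/
theorem carrier_imageRestrict_of_not_finite {c : PointConfig E} (h : ¬ (c.carrier ∩ s).Finite) :
    (c.imageRestrict g s).carrier = ∅ :=
  if_neg h

/-- The image of a restricted configuration "is" the image set `g '' (c ∩ s)` when `c ∩ s` is
finite (Kingman 1993, §2.3). [cite: Kingman1993, §2.3] -/
theorem coe_imageRestrict_of_finite {c : PointConfig E} (h : ((c : Set E) ∩ s).Finite) :
    ((c.imageRestrict g s : PointConfig F) : Set F) = g '' ((c : Set E) ∩ s) :=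
  carrier_imageRestrict_of_finite h

/-- The image configuration always lies in `g '' s` (also in the junk case). [folklore] -/
theorem coe_imageRestrict_subset (g : E → F) (s : Set E) (c : PointConfig E) :
    ((c.imageRestrict g s : PointConfig F) : Set F) ⊆ g '' s := by
  by_cases h : (c.carrier ∩ s).Finite
  · rw [coe_eq_carrier, carrier_imageRestrict_of_finite h]
    exact image_mono inter_subset_right
  · rw [coe_eq_carrier, carrier_imageRestrict_of_not_finite h]
    exact empty_subset _

/-- The image configuration `c.imageRestrict g s` depends only on the restricted set `c ∩ s`.
[folklore] -/
theorem imageRestrict_eq_of_inter_eq {s' : Set E} {c c' : PointConfig E}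
    (h : c.carrier ∩ s = c'.carrier ∩ s') : c.imageRestrict g s = c'.imageRestrict g s' := by
  ext y
  change y ∈ (c.imageRestrict g s).carrier ↔ y ∈ (c'.imageRestrict g s').carrier
  by_cases hf : (c.carrier ∩ s).Finite
  · have hf' : (c'.carrier ∩ s').Finite := by rwa [← h]
    rw [carrier_imageRestrict_of_finite hf, carrier_imageRestrict_of_finite hf', h]
  · have hf' : ¬ (c'.carrier ∩ s').Finite := by rwa [← h]
    rw [carrier_imageRestrict_of_not_finite hf, carrier_imageRestrict_of_not_finite hf']

/-- Restricting first to `u` and then mapping the points in `s` is mapping the points in `u ∩ s`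
(Kingman 1993, §2.2: iterated restriction). [cite: Kingman1993, §2.2] -/
theorem imageRestrict_restrict (g : E → F) (u s : Set E) (c : PointConfig E) :
    (c.restrict u).imageRestrict g s = c.imageRestrict g (u ∩ s) :=
  imageRestrict_eq_of_inter_eq (by rw [carrier_restrict, inter_assoc])

/-- Mapping the points in `s` only sees the restriction to `s`. [folklore] -/
theorem imageRestrict_restrict_self (g : E → F) (s : Set E) (c : PointConfig E) :
    (c.restrict s).imageRestrict g s = c.imageRestrict g s := by
  rw [imageRestrict_restrict, inter_self]

/-- A locally finite configuration has finitely many points in every relatively compact set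
(Kingman 1993, §2.1). [cite: Kingman1993, §2.1] -/
theorem finite_inter_of_subset_isCompact {s K : Set E} (hK : IsCompact K) (hsK : s ⊆ K)
    (c : PointConfig E) : ((c : Set E) ∩ s).Finite :=
  (c.finite_inter_isCompact K hK).subset (inter_subset_inter_right _ hsK)

/-- Carrier of the image of the restriction to a relatively compact set: `g '' (c ∩ s)`
(Kingman 1993, §2.3). [cite: Kingman1993, §2.3] -/
theorem carrier_imageRestrict {s K : Set E} (hK : IsCompact K) (hsK : s ⊆ K) (c : PointConfig E) :
    (c.imageRestrict g s).carrier = g '' (c.carrier ∩ s) :=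
  carrier_imageRestrict_of_finite (finite_inter_of_subset_isCompact hK hsK c)

/-- The image of the restriction to a relatively compact set "is" the image set `g '' (c ∩ s)`
(Kingman 1993, §2.3). [cite: Kingman1993, §2.3] -/
theorem coe_imageRestrict {s K : Set E} (hK : IsCompact K) (hsK : s ⊆ K) (c : PointConfig E) :
    ((c.imageRestrict g s : PointConfig F) : Set F) = g '' ((c : Set E) ∩ s) :=
  carrier_imageRestrict hK hsK c

/-- Membership in the image of the restriction to a relatively compact set. [folklore] -/
theorem mem_imageRestrict_iff {s K : Set E} (hK : IsCompact K) (hsK : s ⊆ K) (c : PointConfig E)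
    (y : F) : y ∈ c.imageRestrict g s ↔ ∃ x ∈ c, x ∈ s ∧ g x = y := by
  rw [← SetLike.mem_coe, coe_imageRestrict hK hsK, mem_image]
  simp only [mem_inter_iff, SetLike.mem_coe, and_assoc]

/-! ### Counting and measurability -/

/-- **Counts transform by inverse image** (Kingman 1993, §2.3, (2.25): `N*(B) = N(f⁻¹ B)` as long
as the image points are distinct): if `g` is injective on `s` and `c ∩ s` is finite, the number of
image points in `t` is the number of points of `c` in `s ∩ g⁻¹ t`.
[cite: Kingman1993, §2.3 (2.25)] -/
theorem count_imageRestrict_of_finite {c : PointConfig E} (h : ((c : Set E) ∩ s).Finite)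
    (hg : InjOn g s) (t : Set F) :
    (c.imageRestrict g s).count t = c.count (s ∩ g ⁻¹' t) := by
  simp only [count]
  rw [carrier_imageRestrict_of_finite h, ← image_inter_preimage,
    (hg.mono fun x hx => hx.1.2).encard_image, inter_assoc]

/-- **Counts transform by inverse image** on a relatively compact window (Kingman 1993, §2.3,
(2.25)): for `g` injective on the relatively compact set `s`,
`N_{g(c ∩ s)}(t) = N_c(s ∩ g⁻¹ t)`. [cite: Kingman1993, §2.3 (2.25)] -/
theorem count_imageRestrict {s K : Set E} (hK : IsCompact K) (hsK : s ⊆ K) (hg : InjOn g s)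
    (c : PointConfig E) (t : Set F) :
    (c.imageRestrict g s).count t = c.count (s ∩ g ⁻¹' t) :=
  count_imageRestrict_of_finite (finite_inter_of_subset_isCompact hK hsK c) hg t

/-- Counting the image points in the image of `A ⊆ s` counts the points in `A` (`g` injective on
`s`). [folklore] -/
theorem count_imageRestrict_image {s K : Set E} (hK : IsCompact K) (hsK : s ⊆ K) (hg : InjOn g s)
    (c : PointConfig E) {A : Set E} (hA : A ⊆ s) :
    (c.imageRestrict g s).count (g '' A) = c.count A := by
  rw [count_imageRestrict hK hsK hg, inter_comm, hg.preimage_image_inter hA]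

/-- The image configuration has no points outside `g '' s`. [folklore] -/
theorem count_imageRestrict_compl_image (g : E → F) (s : Set E) (c : PointConfig E) :
    (c.imageRestrict g s).count (g '' s)ᶜ = 0 := by
  rw [count, encard_eq_zero, ← subset_empty_iff]
  rintro y ⟨hy, hy'⟩
  exact hy' (coe_imageRestrict_subset g s c hy)

variable [MeasurableSpace E] [MeasurableSpace F]

/-- **Measurability of the image map** for the count σ-algebras: for `g` measurable and injective
on the relatively compact measurable set `s`, every counting map of `c ↦ g(c ∩ s)` is a counting
map `N(s ∩ g⁻¹ t)` of `c` (`count_imageRestrict`), so `measurable_of_count` applies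
(Kingman 1993, §2.1 and §2.3). [cite: Kingman1993, §2.3] -/
@[fun_prop]
theorem measurable_imageRestrict {s K : Set E} (hK : IsCompact K) (hsK : s ⊆ K)
    (hs : MeasurableSet s) (hg : Measurable g) (hinj : InjOn g s) :
    Measurable (PointConfig.imageRestrict g s : PointConfig E → PointConfig F) :=
  measurable_of_count fun t ht => by
    simp only [count_imageRestrict hK hsK hinj]
    exact measurable_count (hs.inter (hg ht))

end PointConfig

/-! ### The Mapping Theorem, restricted form -/

namespace IsPoissonPointProcess

variable [MeasurableSpace E] [MeasurableSpace F] {ν : Measure E} {P : Measure (PointConfig E)}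

/-- Independence transports along a measurable change of variables: if the `g i ∘ T` are
independent under `μ`, the `g i` are independent under `μ.map T` (a local copy of the private
lemma of `PoissonPointProcessProofs.lean`). [folklore] -/
private theorem iIndepFun_map_of_comp {Ω Ω' ι : Type*} [MeasurableSpace Ω] [MeasurableSpace Ω']
    {β : ι → Type*} [∀ i, MeasurableSpace (β i)] {μ : Measure Ω} {T : Ω → Ω'}
    (hT : Measurable T) {g : ∀ i, Ω' → β i} (hg : ∀ i, Measurable (g i))
    (h : iIndepFun (fun i => g i ∘ T) μ) : iIndepFun g (μ.map T) := by
  rw [iIndepFun_iff_measure_inter_preimage_eq_mul] at h ⊢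
  intro S sets hsets
  have hmeas : ∀ i ∈ S, MeasurableSet (g i ⁻¹' sets i) := fun i hi => hg i (hsets i hi)
  have h1 : ∀ i ∈ S, μ.map T (g i ⁻¹' sets i) = μ ((g i ∘ T) ⁻¹' sets i) := fun i hi => by
    rw [Measure.map_apply hT (hmeas i hi), Set.preimage_comp]
  rw [Finset.prod_congr rfl h1, Measure.map_apply hT (Finset.measurableSet_biInter S hmeas),
    Set.preimage_iInter₂]
  simpa only [Set.preimage_comp] using h S hsets

/-- **Mapping Theorem, restricted form** (Kingman, *Poisson Processes* (1993), §2.3 Mapping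
Theorem, p. 18, via (2.24)–(2.26), combined with the Restriction Theorem of §2.2, p. 17): let `P`
be a Poisson point process on `E` with intensity `ν`, let `s ⊆ E` be measurable and relatively
compact, and let `g : E → F` be measurable and injective on `s`. Then the law
`P.map (PointConfig.imageRestrict g s)` of the image configuration `g(c ∩ s)` is a Poisson point
process on `F` with intensity `(ν.restrict s).map g`, i.e. `t ↦ ν (g⁻¹ t ∩ s)`. Indeed
`N*(t) = N(s ∩ g⁻¹ t)` (`PointConfig.count_imageRestrict`) is Poisson with mean `ν (g⁻¹ t ∩ s)`
when this is finite, and pairwise disjoint measurable `t₁, …, tₙ` give pairwise disjoint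
measurable `s ∩ g⁻¹ tᵢ`, whose counts are independent under `P`; independence is transported to
the image law along the measurable map `PointConfig.imageRestrict g s`. No σ-finiteness or
non-atomicity hypothesis is needed in this injective case.
[cite: Kingman1993, §2.3 Mapping Theorem, p. 18, (2.24)–(2.26)] -/
theorem map_imageRestrict (hP : IsPoissonPointProcess ν P) {g : E → F} (hg : Measurable g)
    {s K : Set E} (hK : IsCompact K) (hsK : s ⊆ K) (hs : MeasurableSet s) (hinj : InjOn g s) :
    IsPoissonPointProcess ((ν.restrict s).map g) (P.map (PointConfig.imageRestrict g s)) := by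
  haveI := hP.isProbabilityMeasure
  have hT : Measurable (PointConfig.imageRestrict g s : PointConfig E → PointConfig F) :=
    PointConfig.measurable_imageRestrict hK hsK hs hg hinj
  refine ⟨Measure.isProbabilityMeasure_map hT.aemeasurable, fun t ht hfin => ?_,
    fun n t ht hd => ?_⟩
  · -- one-dimensional marginals: `N*(t) = N(s ∩ g⁻¹ t) ~ Poisson (ν (g⁻¹ t ∩ s))`
    rw [Measure.map_apply hg ht, Measure.restrict_apply (hg ht)] at hfin ⊢
    have hcomp : (fun c : PointConfig F => c.count t) ∘ PointConfig.imageRestrict g s =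
        fun c : PointConfig E => c.count (g ⁻¹' t ∩ s) := by
      funext c
      change (PointConfig.imageRestrict g s c).count t = c.count (g ⁻¹' t ∩ s)
      rw [PointConfig.count_imageRestrict hK hsK hinj, Set.inter_comm]
    rw [Measure.map_map (PointConfig.measurable_count ht) hT, hcomp]
    exact hP.map_count ((hg ht).inter hs) hfin
  · -- independence: pairwise disjoint sets have pairwise disjoint inverse images in `s`
    refine iIndepFun_map_of_comp hT (fun i => PointConfig.measurable_count (ht i)) ?_
    have hcomp : (fun i => (fun c : PointConfig F => c.count (t i)) ∘ PointConfig.imageRestrict g s)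
        = fun i (c : PointConfig E) => c.count (s ∩ g ⁻¹' t i) := by
      funext i c
      exact PointConfig.count_imageRestrict hK hsK hinj c (t i)
    rw [hcomp]
    exact hP.iIndepFun_count (fun i => hs.inter (hg (ht i)))
      (hd.mono fun i j hij =>
        Disjoint.mono Set.inter_subset_right Set.inter_subset_right (Disjoint.preimage g hij))

end IsPoissonPointProcess

end Literature.Analysis.FunctionSpaces
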